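import Summits.KontsevichZagierPeriods.Zeta5Search.RVFlatGaugeCap
import HarnessLib

/-!
# RVFlatGaugeCapRay — an unbalanced ray where THEOREM W⁺ is new, all `n` (fam-rv gen 8, file 4/4, optional)

HONEST FRAMING: systematic search; no irrationality claim unless certified.  A worked ALL-`n` instance of
`RVFlatGaugeCap.lean` (THEOREM W⁺), nothing conjectural used, no γ / measure claim (the ray is far from Brown–Zudilin's
record direction and carries no arithmetic interest of its own: it only exhibits the new proved domain).

THE RAY `b = n·(20; 9,9,6,6,6,6,1)` (`Cap.bUnb n`; `d = 17n`, `m₁ = 13n`, blocks `2n,2n,8n,8n,8n,8n,18n`).  For every prime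
`p > 8n` (`p ≥ 5`), every admissible direction and EVERY `σ ∈ S₇`:  `v_p C_j(b) ≥ −e_D♭(b,p) − v_p ρ(σ•b)`
(`Cap.unbalancedRayFlat`).  Breakdown: `8n < p ≤ 9n` — two lower parameters (`9n, 9n`) are `≥ p`, so neither gen-7's
window (`p > 9n`) nor gen-6's `p > m₁ = 13n` applies, and W⁺ (`nbig ≤ 2`) is the only proof; `p > 9n` — gen-7's window.
For `p ≤ 8n` four blocks are `≥ p` (zone C: two or more long blocks), where the flat law is OBSERVED, not proved.
-/

namespace Summit.KontsevichZagierPeriods.Zeta5Search.RVFlatGauge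

open Finset
open Summit.KontsevichZagierPeriods.Zeta5Search.CasoratianValuation (casoratian shift InPolytope pairFloors refund)
open Summit.KontsevichZagierPeriods.Zeta5Search.WedgeDictionary (dOf Epairs)
open Summit.KontsevichZagierPeriods.Zeta5Search.SymmetricGauge
open Summit.KontsevichZagierPeriods.Zeta5Search.DualSeries (InBox)

namespace Cap

/-- The unbalanced ray `b = n·(20; 9, 9, 6, 6, 6, 6, 1)`. -/
def bUnb (n : ℕ) : ℕ → ℤ := fun i => (n : ℤ) * (([20, 9, 9, 6, 6, 6, 6, 1] : List ℤ).getD i 0)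

/-- `bUnb n` lies in the polytope. -/
theorem inPolytope_bUnb (n : ℕ) : InPolytope (bUnb n) := by
  refine ⟨⟨?_, ?_⟩, ?_, ?_⟩
  · simp [bUnb]
  · intro j hj
    simp only [Finset.mem_range] at hj
    interval_cases j <;> simp [bUnb] <;> omega
  · intro i hi
    simp only [Finset.mem_range] at hi
    interval_cases i <;> simp [bUnb] <;> omega
  · simp [bUnb, Finset.sum_range_succ]; omega

/-- All seven contiguous shifts of `bUnb n` stay in the polytope (`n ≥ 1`; the direction has slack `2b_k ≤ b₀ − 2`). -/
theorem inPolytope_shift_bUnb (n j : ℕ) (hn : 1 ≤ n) (hj1 : 1 ≤ j) (hj7 : j ≤ 7) :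
    InPolytope (shift (bUnb n) j) := by
  interval_cases j <;>
  · refine ⟨⟨?_, ?_⟩, ?_, ?_⟩
    · simp [shift, bUnb]
    · intro i hi
      simp only [Finset.mem_range] at hi
      interval_cases i <;> simp [shift, bUnb, Function.update] <;> omega
    · intro i hi
      simp only [Finset.mem_range] at hi
      interval_cases i <;> simp [shift, bUnb, Function.update] <;> omega
    · simp [shift, bUnb, Function.update, Finset.sum_range_succ]; omega

/-- On the ray at most two lower parameters (`b₁ = b₂ = 9n`) can be `≥ p` once `p > 8n`. -/
theorem nbig_bUnb_le_two (n : ℕ) {p : ℕ} (hpn : 8 * n < p) : nbig (bUnb n) p ≤ 2 := by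
  unfold nbig
  have hsub : (univ.filter fun k : Fin 7 => (p : ℤ) ≤ bUnb n (k.val + 1)) ⊆ ({0, 1} : Finset (Fin 7)) := by
    intro k hk
    have hk' := (mem_filter.1 hk).2
    have h8 : (8 * n : ℤ) < p := by exact_mod_cast hpn
    fin_cases k <;> simp [bUnb] at hk' ⊢ <;> omega
  exact (card_le_card hsub).trans (by decide)

/-- **THEOREM W⁺ on the unbalanced ray, ALL `n`, ALL labellings, every prime `p > 8n`.** -/
theorem unbalancedRayFlat (n j p : ℕ) (σ : Equiv.Perm (Fin 7)) (hn : 1 ≤ n) (hj1 : 1 ≤ j) (hj7 : j ≤ 7)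
    (hprime : p.Prime) (hp5 : 5 ≤ p) (hpn : 8 * n < p) (hcas : casoratian (bUnb n) j ≠ 0) :
    -eDflat (bUnb n) p - padicValRat p (rhoB (permLower σ (bUnb n))) ≤ padicValRat p (casoratian (bUnb n) j) := by
  refine flatGaugeLaw_of_nbig_le_two (bUnb n) σ (inPolytope_bUnb n) hj1 hj7 (inPolytope_shift_bUnb n j hn hj1 hj7)
    hprime hp5 (i := 6) ?_ (nbig_bUnb_le_two n hpn) hcas
  intro k hk
  have hk7 := mem_range.1 (mem_erase.1 hk).2
  have hki := (mem_erase.1 hk).1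
  interval_cases k <;> simp [bUnb] <;> omega

/-! ### Kernel instance -/

/-- `n = 2`, `p = 17 ∈ (8n, 9n] = (16, 18]`: the data — lower parameters `18, 18 ≥ 17` (`nbig = 2`), blocks
`4, 4, 16, 16, 16, 16, 36` (one long), `d = 34 ≥ 2·17` (so (CAP) reads `2 + 1 = 3 ≤ 3`), `m₁ = 26`. -/
example : nbig (bUnb 2) 17 = 2 ∧ dOf (bUnb 2) = 34 ∧ m1 (bUnb 2) = 26 ∧
    ((List.range 7).map fun k => bUnb 2 0 - 2 * bUnb 2 (k + 1)) = [4, 4, 16, 16, 16, 16, 36] := by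
  decide

end Cap

end Summit.KontsevichZagierPeriods.Zeta5Search.RVFlatGauge
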